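/-
Copyright: lit-balaban cell, Phase-2 proof seat p11 (gen 4).  Statement-level skeleton of a published paper; no proof claims beyond
what the kernel checks below.
-/
import Literature.MathematicalPhysics.QuantumFieldTheory.BalabanImbrieJaffe1984to88.BIJ85BlockAveragingIneq
import Literature.MathematicalPhysics.QuantumFieldTheory.BalabanImbrieJaffe1984to88.BIJ85ScalarPropagatorTorusK

/-!
# `BalabanImbrieJaffe1984to88.BIJ85FluctuationCovariance` — T. Bałaban, J. Imbrie, A. Jaffe, *Renormalization of the Higgs model:
minimizers, propagators and the stability of mean field theory*, Commun. Math. Phys. **97** (1985) 299–329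
[BalabanImbrieJaffe1985]: Sect. 4.6 p. 313, last clause — **the scalar fluctuation covariance `C^{(k)}(u_k)` of [3] (2.31)
(`C^{(k)} = (aL^{−2}P + Δ^{(k)})^{−1}`) with background `u_k` IS WELL DEFINED AT EVERY `U(1)` BACKGROUND** on the torus model of record:
`a′Q(u^{(k)})^*Q(u^{(k)}) + Δ_k(u)` is POSITIVE DEFINITE on the unit-lattice scalar fields for every `u`, every `k` (standing range),
every `a, a′ > 0` — hence invertible, with a symmetric two-sided inverse.

statement-level skeleton of published theorems with citation tags; proofs where landed; nothing here is a claim about the Yang–Mills mass gap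

PDF held: `paper:balaban1985-cmp97-bij-higgs-minimizers` (journal page = PDF page + 298), p. 313 [PDF 15]; [3] = [Balaban1982Higgs1]
`paper:balaban1982-cmp85-higgs23-i` (journal page = PDF page + 602), p. 611 [PDF 9] read this session (`lit read`).

CITATION HEADER (lean-in-tree rule).  Phase-2 file of the lit-balaban TYPED SKELETON (HOME `run/shared/lean/pub/lit-balaban/`), seat
p11 gen 4 (unit `lit-balaban-p11-g4`; TAKING line HOME/STATUS.md 2026-08-21T07:02:51Z; owner r15, referee ref-5; third target of the
generation, own lane = the C1 scalar sector §4.6).  WHAT IS REPRODUCED: row **C1.Eq4.6.2-4.6.4**, its last clause (*"The other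
propagators such as C^{(k)}(u_k) are defined as in [3] …"*), KNITTED with row **B1.Eq2.30** ([3] (2.30)–(2.32), owner r14; on the B1
carriers the well-definedness remark is proved WITH A MASS `m² > 0` at every `A` — p35's `Balaban1983to89.B1Eq230FluctCov.isUnit_precOpA`,
where `−Δ_A + m² > 0` does the work — and at `U = 1`, `B1RG242Torus.C_arg`) — here on the C1 carriers of record, MASSLESS, at EVERY
background: positivity comes from the NEXT averaging term `a′P` and the absence of zero modes of `(D_u, Q_{k+1}(u))` (kind
«model-instance»; theorems + one operator `def` with body).

THE PRINTED TEXT, verbatim.  p. 313 [PDF 15]: *"The quadratic form which arises for the scalar field is ⟨ψ, Δ_k(u_k)ψ⟩, where ψ is the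
unit lattice scalar field and where Δ_k(u_k) = a_kI − a_k²Q_k(u_k)G_k(u_k)Q_k^*(u_k). (4.6.4) … The other propagators such as
C^{(k)}(u_k) are defined as in [3] with the only change that the background gauge field is u_k."*  [3] p. 611 [PDF 9]: *"In the sequel
we will use the covariance rescaled to the unit lattice and it is of the form C^{(k)}(Ω, A) = (aL^{−2}P(A) + Δ^{(k)}(Ω, A))^{−1}. (2.31)
It is not clear from the formulas (2.30), (2.31) that the covariances are well defined. It is so, and it is one of the assertions of
Proposition 2.3."* (`P = Q^*Q` (2.20) of [3], the NEXT averaging; with background `u_k` the next average is the covariant (2.6) with the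
transports of `u^{(k)}` = `lineIter u k`, so that `Q(u^{(k)}) ∘ Q_k(u) = Q_{k+1}(u)` — gen 3's `qCovK_succ`.)

WHAT IS PROVED (0 `sorry`, standard axioms).  Carriers of record only (gens 2–3: `FineSp`/`CoarseSpK`/`CoarseSp`, `Dlin c u`, `QlinK u k`
= `Q_k(u)`, `Qlin (lineIter u k)` = `Q(u^{(k)})`, `Δ_k(u) = BIJ85ScalarForm464.deltaOp (QlinK u k) a G`, `G = G_k(u)` the inverse (4.6.2)).
* §1 (abstract inner-product spaces) `covOp Q a G Q′ a′ = a′Q′^*Q′ + Δ` — the operator inverted in (2.31) of [3] (`a′` standing for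
  `aL^{−2}`); `⟨ψ, covOp ψ⟩ = a′‖Q′ψ‖² + ⟨ψ, Δψ⟩`; it is symmetric when `G` is (`covOp_symm`); a linear endomorphism of a finite-dimensional
  space with `⟨ψ, Tψ⟩ > 0` for `ψ ≠ 0` has a two-sided inverse (`exists_inverse_of_pos`, p30's `LinearEquiv.ofInjectiveEndo` route), symmetric
  if `T` is (`inverse_symm_of_symm`).
* §2 **`eq_zero_of_inner_deltaOp_eq_zero_of_qCov_eq_zero`**: on the torus, for every `u`, `a > 0`, `c ≠ 0`, `j + k + 1 ≤ m + K`: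
  `⟨ψ, Δ_k(u)ψ⟩ = 0` and `Q(u^{(k)})ψ = 0` force `ψ = 0` — by the variational identity `⟨ψ, Δ_kψ⟩ = a‖Q_kφ_k − ψ‖² + ‖D_uφ_k‖²`
  (`BIJ85BlockAveragingIneq.inner_deltaOp_eq`) `ψ = Q_k(u)φ_k` with `D_uφ_k = 0`, so `Q_{k+1}(u)φ_k = Q(u^{(k)})ψ = 0` and gen 3's NO ZERO
  MODES at level `k + 1` (`BIJ85ScalarPropagatorTorusK.eq_zero_of_covD_eq_zero_of_qCovK_eq_zero`) gives `φ_k = 0`.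
* **`hposC_torusK`**: `a′‖Q(u^{(k)})ψ‖² + ⟨ψ, Δ_k(u)ψ⟩ > 0` for `ψ ≠ 0` (every `u`, `a, a′ > 0`); **`exists_C`**: the operator
  `a′Q(u^{(k)})^*Q(u^{(k)}) + Δ_k(u)` has a two-sided inverse `C^{(k)}(u)` — *"It is so"* AT EVERY BACKGROUND, massless, no smallness of
  `u`; `C_symm`: `C^{(k)}(u)` is symmetric.
HONEST SCOPE.  Existence/positive-definiteness only: NO bound `γ₀I ≤ a′P + Δ_k` uniform in `k`, the volume or `u` is claimed (that is
Prop. 2.3 (2.33) of [3] at regular backgrounds, resp. (7.3.2) of C1; at the flat background see `BIJ85Ineq732Flat`).  The identification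
`a′ = aL^{−2}` and the unit-lattice rescaling of [3] (2.30)→(2.31) are not re-derived here (`a′ > 0` arbitrary).
-/

open scoped RealInnerProductSpace BigOperators
open Finset

namespace Literature.MathematicalPhysics.QuantumFieldTheory.BalabanImbrieJaffe1984to88.BIJ85FluctuationCovariance

open Literature.MathematicalPhysics.QuantumFieldTheory.Balaban1983to89
open BIJ88Sect3Statements (U1 toC cfg covD)
open BIJ85Sect1Model (HiggsField)
open BIJ85BlockAveragesTorus BIJ85BlockAveragesTorusK BIJ85ScalarPropagatorTorus BIJ85ScalarPropagatorTorusK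
open BIJ85ScalarForm464 BIJ85Eq461Proof BIJ85BlockAveragingIneq

noncomputable section

variable {P : Params} {j : ℕ}

/-! ## §1 Abstract: the operator of (2.31) of [3], `a′Q′^*Q′ + Δ_k`, and its form -/

section Abstract

variable {Φ Ψ Φ₁ Φ₂ : Type*} [NormedAddCommGroup Φ] [InnerProductSpace ℝ Φ] [NormedAddCommGroup Ψ] [InnerProductSpace ℝ Ψ]
  [NormedAddCommGroup Φ₁] [InnerProductSpace ℝ Φ₁] [NormedAddCommGroup Φ₂] [InnerProductSpace ℝ Φ₂]
  [FiniteDimensional ℝ Φ] [FiniteDimensional ℝ Ψ] [FiniteDimensional ℝ Φ₁] [FiniteDimensional ℝ Φ₂]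

/-- **The operator of [3] (2.31) with background `u_k`**: `a′Q′^*Q′ + Δ`, `Δ = aI − a²QGQ^*` the scalar form (4.6.4) (gen 2's
`BIJ85ScalarForm464.deltaOp`), `Q′` the NEXT averaging operator, `a′` its Gaussian constant (`aL^{−2}` in [3]); its inverse is the
fluctuation covariance `C^{(k)}(u_k)` — *"The other propagators such as C^{(k)}(u_k) are defined as in [3] with the only change that the
background gauge field is u_k"*. [cite: BalabanImbrieJaffe1985, (4.6.4) p.313] -/
def covOp (Q : Φ →ₗ[ℝ] Φ₁) (a : ℝ) (G : Φ →ₗ[ℝ] Φ) (Q' : Φ₁ →ₗ[ℝ] Φ₂) (a' : ℝ) : Φ₁ →ₗ[ℝ] Φ₁ :=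
  a' • (Q'.adjoint ∘ₗ Q') + deltaOp Q a G

/-- kernel: `⟨ψ, (a′Q′^*Q′ + Δ)ψ⟩ = a′‖Q′ψ‖² + ⟨ψ, Δψ⟩`. [cite: BalabanImbrieJaffe1985, (4.6.4) p.313] -/
theorem inner_covOp (Q : Φ →ₗ[ℝ] Φ₁) (a : ℝ) (G : Φ →ₗ[ℝ] Φ) (Q' : Φ₁ →ₗ[ℝ] Φ₂) (a' : ℝ) (ψ : Φ₁) :
    ⟪ψ, covOp Q a G Q' a' ψ⟫ = a' * ‖Q' ψ‖ ^ 2 + ⟪ψ, deltaOp Q a G ψ⟫ := by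
  simp only [covOp, LinearMap.add_apply, LinearMap.smul_apply, LinearMap.coe_comp, Function.comp_apply, inner_add_right,
    real_inner_smul_right, LinearMap.adjoint_inner_right, real_inner_self_eq_norm_sq]

/-- kernel (p30's `BIJ85Eq461Proof.exists_inverse` route, abstracted): a linear endomorphism `T` of a finite-dimensional real inner-product
space with `⟨ψ, Tψ⟩ > 0` for all `ψ ≠ 0` is injective, hence bijective (`LinearEquiv.ofInjectiveEndo`): it has a two-sided inverse.
[cite: Balaban1982Higgs1, (2.31) p.611] -/
theorem exists_inverse_of_pos (T : Φ₁ →ₗ[ℝ] Φ₁) (hpos : ∀ ψ : Φ₁, ψ ≠ 0 → 0 < ⟪ψ, T ψ⟫) :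
    ∃ C : Φ₁ →ₗ[ℝ] Φ₁, (∀ ψ, T (C ψ) = ψ) ∧ ∀ ψ, C (T ψ) = ψ := by
  have hinj : Function.Injective T := by
    rw [← LinearMap.ker_eq_bot, LinearMap.ker_eq_bot']
    intro ψ hψ
    by_contra hne
    have h := hpos ψ hne
    rw [hψ, inner_zero_right] at h
    exact lt_irrefl _ h
  refine ⟨((LinearEquiv.ofInjectiveEndo _ hinj).symm : Φ₁ →ₗ[ℝ] Φ₁), fun ψ => ?_, fun ψ => ?_⟩
  · rw [LinearEquiv.coe_coe]
    have h := (LinearEquiv.ofInjectiveEndo _ hinj).apply_symm_apply ψ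
    rwa [LinearEquiv.coe_ofInjectiveEndo] at h
  · rw [LinearEquiv.coe_coe]
    have h := (LinearEquiv.ofInjectiveEndo _ hinj).symm_apply_apply ψ
    rwa [LinearEquiv.coe_ofInjectiveEndo] at h

/-- kernel: `a′Q′^*Q′ + Δ` is symmetric when `G` is (`⟨Gx, y⟩ = ⟨x, Gy⟩`; for the inverse of (4.6.2) this is p30's `inverse_symm`).
[cite: BalabanImbrieJaffe1985, (4.6.4) p.313] -/
theorem covOp_symm (Q : Φ →ₗ[ℝ] Φ₁) (a : ℝ) {G : Φ →ₗ[ℝ] Φ} (hGs : ∀ x y, ⟪G x, y⟫ = ⟪x, G y⟫) (Q' : Φ₁ →ₗ[ℝ] Φ₂) (a' : ℝ)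
    (x y : Φ₁) : ⟪covOp Q a G Q' a' x, y⟫ = ⟪x, covOp Q a G Q' a' y⟫ := by
  simp only [covOp, deltaOp, LinearMap.add_apply, LinearMap.smul_apply, LinearMap.sub_apply, LinearMap.id_apply,
    LinearMap.coe_comp, Function.comp_apply, inner_add_left, inner_add_right, inner_sub_left, inner_sub_right,
    real_inner_smul_left, real_inner_smul_right, LinearMap.adjoint_inner_left, LinearMap.adjoint_inner_right]
  have h1 : ⟪Q (G (Q.adjoint x)), y⟫ = ⟪x, Q (G (Q.adjoint y))⟫ := by
    rw [← LinearMap.adjoint_inner_right Q, hGs, ← LinearMap.adjoint_inner_left Q]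
  rw [h1]

omit [FiniteDimensional ℝ Φ₁] in
/-- kernel: a right inverse of a symmetric operator is symmetric. [cite: Balaban1982Higgs1, (2.31) p.611] -/
theorem inverse_symm_of_symm {T C : Φ₁ →ₗ[ℝ] Φ₁} (hTs : ∀ x y, ⟪T x, y⟫ = ⟪x, T y⟫) (hC : ∀ ψ, T (C ψ) = ψ) (x y : Φ₁) :
    ⟪C x, y⟫ = ⟪x, C y⟫ := by
  conv_lhs => rw [← hC y]
  conv_rhs => rw [← hC x]
  rw [← hTs]

end Abstract

/-! ## §2 The torus model: `⟨ψ, Δ_k(u)ψ⟩ = 0` forces `ψ = 0` on the range where `Q(u^{(k)})ψ = 0` -/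

/-- **The kernel of the form `a′‖Q(u^{(k)})ψ‖² + ⟨ψ, Δ_k(u)ψ⟩` is trivial, at EVERY background**: on the torus model (`u` any `U(1)` field,
`a > 0`, `c ≠ 0`, `j + k + 1 ≤ m + K`, `G` the inverse of (4.6.2)), `⟨ψ, Δ_k(u)ψ⟩ = 0` together with `Q(u^{(k)})ψ = 0` forces `ψ = 0`.  Proof:
`⟨ψ, Δ_kψ⟩ = a‖Q_k(u)φ_k − ψ‖² + ‖D_uφ_k‖²` at the minimizer `φ_k = aG_kQ_k^*ψ` (`BIJ85BlockAveragingIneq.inner_deltaOp_eq`), so `ψ = Q_k(u)φ_k` and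
`D_uφ_k = 0`; then `Q_{k+1}(u)φ_k = Q(u^{(k)})(Q_k(u)φ_k) = Q(u^{(k)})ψ = 0` (gen 3's `qCovK_succ`) and the NO-ZERO-MODES theorem at level `k + 1`
(`BIJ85ScalarPropagatorTorusK.eq_zero_of_covD_eq_zero_of_qCovK_eq_zero`) gives `φ_k = 0`, whence `ψ = 0`.
[cite: BalabanImbrieJaffe1985, (4.6.4) p.313] -/
theorem eq_zero_of_inner_deltaOp_eq_zero_of_qCov_eq_zero {k : ℕ} (hk : j + k + 1 ≤ P.m + P.K) {c : ℝ} (hc : c ≠ 0) {a : ℝ}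
    (ha : 0 < a) (U : GaugeField P j U1) {G : FineSp P j →ₗ[ℝ] FineSp P j}
    (hG : ∀ φ, opT (Dlin c U) (QlinK U k) a (G φ) = φ) {ψ : CoarseSpK P j k}
    (hΔ : ⟪ψ, deltaOp (QlinK U k) a G ψ⟫ = 0) (hQ : Qlin (lineIter U k) ψ = 0) : ψ = 0 := by
  set φk : FineSp P j := phiCl (QlinK U k) a G ψ with hφk
  have hval := inner_deltaOp_eq (D := Dlin c U) hG ψ
  rw [hΔ] at hval
  have h1 : a * ‖QlinK U k φk - ψ‖ ^ 2 = 0 := by nlinarith [sq_nonneg ‖QlinK U k φk - ψ‖, sq_nonneg ‖Dlin c U φk‖]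
  have h2 : ‖Dlin c U φk‖ ^ 2 = 0 := by nlinarith [sq_nonneg ‖QlinK U k φk - ψ‖, sq_nonneg ‖Dlin c U φk‖]
  have hQψ : QlinK U k φk = ψ := by
    have : ‖QlinK U k φk - ψ‖ ^ 2 = 0 := by
      rcases mul_eq_zero.1 h1 with h | h
      · exact absurd h ha.ne'
      · exact h
    rwa [sq_eq_zero_iff, norm_eq_zero, sub_eq_zero] at this
  have hD : Dlin c U φk = 0 := by rwa [sq_eq_zero_iff, norm_eq_zero] at h2
  -- D_uφ_k = 0 and Q_{k+1}(u)φ_k = Q(u^{(k)})(Q_k(u)φ_k) = Q(u^{(k)})ψ = 0 ⇒ φ_k = 0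
  have hφ0 : WithLp.ofLp φk = 0 := by
    refine eq_zero_of_covD_eq_zero_of_qCovK_eq_zero hc (U := U) (φ := WithLp.ofLp φk)
      (fun b => by rw [← Dlin_apply, hD, PiLp.zero_apply]) (k + 1) hk fun y => ?_
    have hy := congrArg (fun χ : CoarseSp P (j+k) => χ y) hQ
    simp only [PiLp.zero_apply, Qlin_apply] at hy
    rw [qCovK_succ]
    convert hy using 2
    funext z
    rw [← hQψ, QlinK_apply]
  have hφk0 : φk = 0 := (WithLp.ofLp_eq_zero (p := 2)).1 hφ0
  rw [← hQψ, hφk0, map_zero]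

/-- **`a′Q(u^{(k)})^*Q(u^{(k)}) + Δ_k(u)` IS POSITIVE DEFINITE AT EVERY BACKGROUND**: for every `U(1)` field `u` on the torus, every `k` with
`j + k + 1 ≤ m + K`, `a, a′ > 0`, `c ≠ 0`, `G` the inverse of (4.6.2): `a′‖Q(u^{(k)})ψ‖² + ⟨ψ, Δ_k(u)ψ⟩ > 0` for `ψ ≠ 0` (both terms are
`≥ 0`, `BIJ85BlockAveragingIneq.inner_deltaOp_nonneg`, and their joint kernel is trivial). [cite: Balaban1982Higgs1, (2.31) p.611] -/
theorem hposC_torusK {k : ℕ} (hk : j + k + 1 ≤ P.m + P.K) {c : ℝ} (hc : c ≠ 0) {a a' : ℝ} (ha : 0 < a) (ha' : 0 < a')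
    (U : GaugeField P j U1) {G : FineSp P j →ₗ[ℝ] FineSp P j} (hG : ∀ φ, opT (Dlin c U) (QlinK U k) a (G φ) = φ) :
    ∀ ψ : CoarseSpK P j k, ψ ≠ 0 → 0 < a' * ‖Qlin (lineIter U k) ψ‖ ^ 2 + ⟪ψ, deltaOp (QlinK U k) a G ψ⟫ := by
  intro ψ hψ
  have h1 : 0 ≤ a' * ‖Qlin (lineIter U k) ψ‖ ^ 2 := by positivity
  have h2 : 0 ≤ ⟪ψ, deltaOp (QlinK U k) a G ψ⟫ := inner_deltaOp_nonneg (D := Dlin c U) hG ha.le ψ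
  rcases (add_nonneg h1 h2).lt_or_eq with h | h
  · exact h
  · exfalso
    have hQ0 : a' * ‖Qlin (lineIter U k) ψ‖ ^ 2 = 0 := by linarith
    have hΔ0 : ⟪ψ, deltaOp (QlinK U k) a G ψ⟫ = 0 := by linarith
    have hQ : Qlin (lineIter U k) ψ = 0 := by
      rcases mul_eq_zero.1 hQ0 with h' | h'
      · exact absurd h' ha'.ne'
      · rwa [sq_eq_zero_iff, norm_eq_zero] at h'
    exact hψ (eq_zero_of_inner_deltaOp_eq_zero_of_qCov_eq_zero hk hc ha U hG hΔ0 hQ)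

/-- **[3] (2.31) *"It is not clear from the formulas (2.30), (2.31) that the covariances are well defined. It is so"* — AT EVERY `U(1)`
BACKGROUND on the torus model of C1** (*"with the only change that the background gauge field is u_k"*, p. 313): for every `u`, every `k`
with `j + k + 1 ≤ m + K`, `a, a′ > 0`, `c ≠ 0` and `G = G_k(u)` the inverse of (4.6.2), the operator `a′Q(u^{(k)})^*Q(u^{(k)}) + Δ_k(u)` on the
unit-lattice scalar fields has a two-sided inverse `C^{(k)}(u)` (massless; no smallness or regularity of `u` is needed for EXISTENCE).
[cite: Balaban1982Higgs1, (2.31) p.611] -/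
theorem exists_C {k : ℕ} (hk : j + k + 1 ≤ P.m + P.K) {c : ℝ} (hc : c ≠ 0) {a a' : ℝ} (ha : 0 < a) (ha' : 0 < a')
    (U : GaugeField P j U1) {G : FineSp P j →ₗ[ℝ] FineSp P j} (hG : ∀ φ, opT (Dlin c U) (QlinK U k) a (G φ) = φ) :
    ∃ C : CoarseSpK P j k →ₗ[ℝ] CoarseSpK P j k,
      (∀ ψ, covOp (QlinK U k) a G (Qlin (lineIter U k)) a' (C ψ) = ψ) ∧
      ∀ ψ, C (covOp (QlinK U k) a G (Qlin (lineIter U k)) a' ψ) = ψ :=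
  exists_inverse_of_pos _ fun ψ hψ => by
    rw [inner_covOp]
    exact hposC_torusK hk hc ha ha' U hG ψ hψ

/-- kernel: the fluctuation covariance `C^{(k)}(u)` is symmetric (the operator is: `covOp_symm` with p30's `inverse_symm` for `G_k(u)`).
[cite: Balaban1982Higgs1, (2.31) p.611] -/
theorem C_symm {k : ℕ} (c a a' : ℝ) (U : GaugeField P j U1) {G : FineSp P j →ₗ[ℝ] FineSp P j}
    (hG : ∀ φ, opT (Dlin c U) (QlinK U k) a (G φ) = φ) {C : CoarseSpK P j k →ₗ[ℝ] CoarseSpK P j k}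
    (hC : ∀ ψ, covOp (QlinK U k) a G (Qlin (lineIter U k)) a' (C ψ) = ψ) (x y : CoarseSpK P j k) :
    ⟪C x, y⟫ = ⟪x, C y⟫ :=
  inverse_symm_of_symm (covOp_symm (QlinK U k) a (inverse_symm (Dlin c U) (QlinK U k) a G hG) (Qlin (lineIter U k)) a') hC x y

end

end Literature.MathematicalPhysics.QuantumFieldTheory.BalabanImbrieJaffe1984to88.BIJ85FluctuationCovariance
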